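import Literature.MathematicalPhysics.QuantumFieldTheory.Balaban1983to89.B9Ineq373HessianPieceBoundsY
import Literature.MathematicalPhysics.QuantumFieldTheory.Balaban1983to89.B9Ineq375GradDivBoundsY
import Literature.MathematicalPhysics.QuantumFieldTheory.Balaban1983to89.B9Cor36GCubeEntriesAtV

/-!
# `Balaban1983to89.B9Ineq373FirstOrderCommY` — [B9] p. 407 «The operator V₃(A) is a local differential operator of the first order satisfying the bound (3.73)»
# READ AGAINST THE RIGHT ENTRY (3.42)₃: the COMMUTATORS of the first-order coefficient letters `V¹_μ` ((3.71), Laplacian piece) and `P¹_μ` ((3.75), gradient–divergence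
# piece) of `Δ_{a,□}(1) − Δ_{a,□}(Ṽ)` with the flat bond derivatives `∇_ν` are ZEROTH-ORDER letters of (3.37)-size `O(1)α₁(Lⁿη)⁻²` — at def-Y's letters, by LATTICE
# TRANSLATION COVARIANCE (`T_V∘σ_a = σ_a∘T_{V(·−e_a)}`) and LIPSCHITZ dependence on the background; realified over r05's cube geometry and instantiated at the localised
# field `Ṽ_□` of the (3.35) cube datum (sub-row G-B9-LETTERS, module M5.1b-G «Cor 3.5∕3.6 for the bond-sector cube letter G_□», FILE G-F8a — the input of the
# divergence-form reading of `V_□ = Δ_{a,□}(1) − Δ_{a,□}(Ṽ_□)` needed for the right entry `G_□(Ṽ_□)∇*`, cell GAPS G-B9-02)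

T. Bałaban, *Propagators for lattice gauge theories in a background field*, Commun. Math. Phys. **99** (1985) 389–434
[`Balaban1985BackgroundPropagators`, "B9"]; [4] = T. Bałaban, *Propagators and renormalization transformations for lattice gauge theories. II*,
Commun. Math. Phys. **96** (1984) 223–250 [`Balaban1984PropagatorsII`].

statement-level skeleton of published theorems with citation tags; proofs where landed; nothing here is a claim about the
Yang–Mills mass gap

THE PRINTED LOCUS (verbatim, held `paper:balaban1985-cmp99-background-propagators`, journal page = PDF page + 388; page owner r06).  p. 405 (3.73): *«The operator V₁
satisfies |(V₁(A)A′)(b)| ≦ O(1)(|∇A||A′| + |A|²|A′|) + O(1)|A|(|∇_UA′| + …) ≦ O(1)α₁((Lʲη)⁻¹|∇_UA′| + (Lʲη)⁻²|A′|), b ∈ Ω_j, (3.73) … The derivatives are, of course, the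
covariant derivatives defined by U.»*; p. 405 (3.75): *«where the operators F_{2,k}(A), V₂(A) satisfy the bounds (3.72), (3.73)»*; p. 407: *«The operator V₃(A) is a
local differential operator of the first order satisfying the bound (3.73) … Theorem (3.3) implies also convergence in all norms appearing in its formulation, thus in all
norms on the left-hand sides of the inequalities (3.42)–(3.47). This way we get all these inequalities for the operator G(U′U)»*; p. 396 (3.37): *«|A′| < α₁(Lʲη)⁻¹,
|∇^η_UA′| < α₁(Lʲη)⁻² on Ω_j»*; p. 398 (remark after Thm 3.1): *«we may always replace ∇_U by ∇*_U, and vice versa, in arbitrary place and combination»*; p. 413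
(3.100) (the lattice product rule).  Here `U = 1` (Cor. 3.6's cube road), so the derivatives are the FLAT `∇_ν`.

WHY THIS FILE (cell `lit-balaban`; module M5.1b-G, p38 g45; successor plan `lit-balaban-p38/RECORD-M51bG-g44.md` §Remaining item 1 «G-F8», cell GAPS G-B9-02).  G-F6b
(`B9Cor36GCubeLocAtMember.eBlock_locLetterBY`, p663680) delivers M5.7's per-cube `hE` MODULO the flat right entry `G_□(Ṽ_□)·∇*_{1,ν} ≺ B₂·Lⁿη·e^{−ρ′d}`.  r06's
letter-free (3.86) engine `B9Ineq386RightEntry.gExt_rightEntry_of_386L` produces it from p33's E1 `B9Thm33CubeAtOneRight.thm33_GK_cube_right` (the right entry of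
`G_□(1)`) and a majorant of the LEFT composite `G_□(1)·V_□ ≺ θe^{−ρd}` — which needs `V_□` with its bond derivatives to the LEFT of the coefficients (divergence form),
whereas G-F5a∕G-F5b typed the first-order parts in GRADIENT form `Σ_μ V¹_μ∘∇_μ`, `Σ_μ P¹_μ∘∇_μ` (the shape serving the left entries, (3.85)).  The passage `V¹_μ∘∇_μ =
∇_μ∘V¹_μ + [V¹_μ, ∇_μ]` costs exactly the commutator, which print's sentence «local differential operator of the first order satisfying the bound (3.73)» together with
(3.37) makes a zeroth-order letter of size `O(1)α₁(Lʲη)⁻²` (r06's `B9Ineq386RightEntry` §5 ∕ `B9Eq373CommLetters` did this at r06's torus letters; no dictionary to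
def-Y's `hessY`∕`gradY`∕`divY` exists).  THIS FILE proves it at def-Y's letters WITHOUT expanding the stencils a second time: every letter `T_V` of G-F5a∕G-F5b
(`sel_μ`, `𝒦_V`, `D*_V`, `W_{V,μ}`, `V¹_μ`, `P¹a_ν`, `P¹b_ν`, `P¹_ν`) is TRANSLATION COVARIANT, `T_V(σ_aX)(b) = (T_{V⁻ᵃ}X)(b + e_a)` with `V⁻ᵃ(y) = V(y − e_a)` (§2), so
`[T_V, ∇_a]X(b) = c_f·((T_{V⁻ᵃ} − T_V)X)(b + e_a)` (`comm_nablaY_apply`), and the letters are LIPSCHITZ in the background with the SAME stencils as G-F5a III ∕ G-F5b II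
(`‖R(u)w − R(u′)w‖ ≦ 2‖u − u′‖‖w‖`, §3): the window of `V⁻ᵃ − V` is the VARIATION window `‖V(y − e_a) − V(y)‖ ≦ α₁(η∕Lⁿη)²` of (3.37), that of `Re V⁻ᵃ(∂p) − Re V(∂p)`
twice the plaquette window.

WHAT THIS FILE PROVES (THEOREMS + `def`s with bodies `bshift` (translated bond), `plaqShift` (plaquette translation, an `Equiv`), `unshCfgY` (`V⁻ᵃ`), the real constant
`cK1 d = 4 + 48(d+1)`; 0 `def … : Prop`, 0 sorry).
* §1 torus bookkeeping: `shift_apply`, `unshift_apply`, `shift_shift_comm`, `unshift_unshift_comm`, `bshift_injective`, `plaqShift_*`, `unshCfgY_apply`∕`_one`,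
  `edgeY_plaqShift`, `edgeParY_unsh`, ★ `holY_unsh` (`U⁻ᵃ(∂(p+e_a)) = U(∂p)`), `reHolY_unsh`∕`imHolY_unsh`∕`reHolY_unsh'`.
* §2 translation covariance: `selY_shift`, `jordanY_shift`, ★ `coCurlY_shift`, `coCurlJordan_shift`, `WY_shift`, ★ `V1Y_shift`, `P1aY_shift`, `P1bY_shift`, ★ `P1Y_shift`,
  ★★ `comm_nablaY_apply` (`(T₁∇_a − ∇_aT₁)X(b) = c_f((T₂ − T₁)X)(b + e_a)` whenever `T₁σ_a = σ_aT₂` pointwise).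
* §3 Lipschitz in the background (raw stencils, two bi-contractive backgrounds): `norm_WY_sub_apply_le`, `norm_jordanY_sub_jordanY_le`, ★ `norm_coCurlJordan_diff_apply_le`
  (`|c_f|·4(d+1)(2ω(1+ω₃) + ω_H)·s`), ★★ `norm_V1Y_sub_apply_le` (`|c_f|(4ω + 8(d+1)(2ω(1+ω₃) + ω_H))·s`), ★★ `norm_P1Y_sub_apply_le` (`|c_f|·c_{P1}(d)·ω·t`).
* §4 ★★ `norm_commV1Y_apply_le` (`‖(V¹_μ∇_ν − ∇_νV¹_μ)X(b)‖ ≦ c_f²(4ω₂ + 8(d+1)(2ω₂(1+ω₃) + 2ω₃))·s`, windows in the distance-3 block neighbourhood of `b`),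
  ★★ `norm_commP1Y_apply_le` (`≦ c_f²·c_{P1}(d)·ω₂·s`).
* §5 realified over `(toB6 (geoCK i □) Rr H, blkBK i □)` by n06-c's READING ⇒ MAJORANT device: `conj_comm_eq`, `cK1`, ★★★ `hasMajorant_commV1Y`
  (`conj b(V¹_μ)·DK ν − DK ν·conj b(V¹_μ) ≺ (M₂Σ‖b_j‖)·c_{K1}(d)e^{3δ}·α₁·(len(a)²)⁻¹·e^{−δd}`, `α₁ ≦ 1`), ★★★ `hasMajorant_commP1Y` (constant `c_{P1}(d)`).
* §6 at `Ṽ_□ = locCfgY i □ η A` of the (3.35) cube datum (bridge II's windows, uniform on the torus): ★★★ `hasMajorant_commV1Y_locCfgY` (`α₁ := α_W(s)`, `α_W(s) ≦ 1`),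
  ★★★ `hasMajorant_commP1Y_locCfgY`.

PROOF.  Ours (the print does not display the step; it is the lattice Leibniz rule (3.100) applied to the coefficients, cf. r06's `B9Ineq386RightEntry` §5 docstring and
`B9Eq373CommLetters`∕`B9Eq373CurvComm` at the torus letters): translation covariance + Lipschitz, the stencil bookkeeping of G-F5a III (`B9Ineq373HessianPieceBoundsY`:
`dSite_shift_le`, `plaq_src_of_edgeY`, `norm_R_sub_R_le`, `norm_jordanY_sub_le`, `norm_selY_apply_le`) and G-F5b II (`B9Ineq375GradDivBoundsY.norm_Rinv_sub_Rinv_le`),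
def-Y's `coCurlY_apply_eq_sum_edgeY` (reindexed by `plaqShift`), n06-c's `B9SectBGpReadingsY.hasMajorant_conj_of_liftY_bound`, bridge II `B9Cor36GCubeWindows` BY NAME.

HONEST SCOPE.  Finite-stencil identities and norm bookkeeping over landed letters; the WINDOWS (variation `‖V(y−e_ν) − V(y)‖`, plaquette `‖Re V(∂p) − 1‖`) are hypotheses
in §4–§5 and come from the (3.35) cube datum in §6 exactly as in bridge II; bi-contractivity of `V` is a hypothesis (§6: Hermitian type `hAu`).  Only the commutators with
the FLAT derivatives are treated (Cor. 3.6's cube road expands around `U = 1`); the zeroth-order parts `V⁰`, `P⁰`, the projection word `P₁` and the averaging piece need no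
commutator.  No propagator here: the assembly of the right entry (E1 + these letters + r06's `gExt_rightEntry_of_386L`) is the next file (G-F8b).  Constants unoptimised.
Count-neutral; NOT a node discharge; no summit ∕ sub-problem statement is proved; nothing continuum ∕ OS ∕ mass-gap ∕ Clay; YM mass gap NOT proved by any of this (Track A
conditional rung).  No `sorry`, no `axiom`, no `… : Prop` fact, no `instance`, no `notation`.  NEW file; nothing landed is modified.  Cell `lit-balaban`, seat
`lit-balaban-p38` gen 45, 2026-08-28; `--supports stmt-QuantumFields-19200` as helper.  Net new unproved facts: 0.

RELATED IN THE TREE, NOT DUPLICATED (searched 2026-08-28: `rg 'V1Y_shift|commV1Y|plaqShift|unshCfgY|comm_nablaY' Literature/` = ∅; `lean search shift_shift_comm` = private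
copies in `B9Eq335PlaquetteAtLettersY`, `B8Thm8U1Family`, a `HiggsLattice` one in `B3Eq14CutoffExists`∕`HiggsHodgeIdentity` — other carriers): r06's torus-letter commutators
`B9Eq373CommLetters`∕`B9Eq373CurvComm`∕`B9Ineq386CommSum` (r06's `V₃(A)` letters, not def-Y's), G-F5a I–III (`B9Eq371HessianSplitY`, `B9Eq371CoCurlLeibnizY`,
`B9Ineq373HessianPieceBoundsY`), G-F5b I–II (`B9Eq375GradDivSplitY`, `B9Ineq375GradDivBoundsY`), G-F6a (`B9Cor36GCubeEntriesAtV.shiftOpB`, USED), bridge II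
(`B9Cor36GCubeWindows`, USED), def-Y's gauge covariance `Node00.OpsYGauge` (gauge, not translation).
-/

noncomputable section

namespace Literature.MathematicalPhysics.QuantumFieldTheory.Balaban1983to89.B9Ineq373FirstOrderCommY

open Node00
open Literature.MathematicalPhysics.QuantumFieldTheory.Balaban1983to89
open Literature.MathematicalPhysics.QuantumFieldTheory.Balaban1983to89.B6KLevelCensusIndexV1 (KIdx kGeo)
open Literature.MathematicalPhysics.QuantumFieldTheory.Balaban1983to89.B6GlobalChartV1 (PV)
open Literature.MathematicalPhysics.QuantumFieldTheory.Balaban1983to89.B9Eq39Adjoint (R R_add R_sub R_smul R_one R_zero R_inv_R)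
open Literature.MathematicalPhysics.QuantumFieldTheory.Balaban1983to89.Node00.OpsYEq3117Identity (coCurlY_apply_eq_sum_edgeY)
open Literature.MathematicalPhysics.QuantumFieldTheory.Balaban1983to89.Node00.OpsYNablaBridge (chartY shiftY_chartY shiftY_symm_chartY unshift_shift shift_unshift)
open Literature.MathematicalPhysics.QuantumFieldTheory.Balaban1983to89.B9Eq371HessianSplitY (nablaY nablaY_apply selY selY_apply)
open Literature.MathematicalPhysics.QuantumFieldTheory.Balaban1983to89.B9Eq371CoCurlLeibnizY (WY WY_apply V1Y unshift_shift_comm)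
open Literature.MathematicalPhysics.QuantumFieldTheory.Balaban1983to89.B9Eq375GradDivSplitY (P1aY P1bY P1Y P1aY_apply_mk P1bY_apply_mk)
open Literature.MathematicalPhysics.QuantumFieldTheory.Balaban1983to89.B9Cor36GCubeEntriesAtV (shiftOpB shiftOpB_apply)
open Literature.MathematicalPhysics.QuantumFieldTheory.Balaban1983to89.B9Ineq373HessianPieceBoundsY (dSite dSite_shift_le dSite_self plaq_src_of_edgeY
  norm_R_sub_R_le norm_Rinv_sub_self_le norm_selY_apply_le norm_jordanY_sub_le abs_cf_eq)
open Literature.MathematicalPhysics.QuantumFieldTheory.Balaban1983to89.B9Ineq375GradDivBoundsY (norm_Rinv_sub_Rinv_le cP1)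
open Literature.MathematicalPhysics.QuantumFieldTheory.Balaban1983to89.B9Ineq369CurvatureSmallAtLettersY (norm_sgnY)
open Literature.MathematicalPhysics.QuantumFieldTheory.Balaban1983to89.B9Eq3104CommutatorSizesCurv (norm_R_edgeParY_le sum_edge_indicator_le)
open Literature.MathematicalPhysics.QuantumFieldTheory.Balaban1983to89.B6RandomWalk (HasMajorant)
open Literature.MathematicalPhysics.QuantumFieldTheory.Balaban1983to89.B9Thm34Ext (toB6)
open Literature.MathematicalPhysics.QuantumFieldTheory.Balaban1983to89.B6Cover236MultiLevelBlocks (cubes)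
open Literature.MathematicalPhysics.QuantumFieldTheory.Balaban1983to89.B9CubeLettersOpsL0 (cubeFamY)
open Literature.MathematicalPhysics.QuantumFieldTheory.Balaban1983to89.B9CubeLettersBondOpsL0 (BlkCubeY)
open Literature.MathematicalPhysics.QuantumFieldTheory.Balaban1983to89.B9Eq360DeltaPrimeACubeY (blkCubeY)
open Literature.MathematicalPhysics.QuantumFieldTheory.Balaban1983to89.B9CubeGeometryInputs (geoCK geoCK_eta geoCK_eta_pos geoCK_len_pos)
open Literature.MathematicalPhysics.QuantumFieldTheory.Balaban1983to89.B6GlobalChartV1L0 (blkV1)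
open Literature.MathematicalPhysics.QuantumFieldTheory.Balaban1983to89.B9Cor35GCubeInputsAtOne (blkBK DK kGeo_eta)
open Literature.MathematicalPhysics.QuantumFieldTheory.Balaban1983to89.B9Cor36GCubeWindows (sRead sRead_nonneg alphaW alphaW_nonneg mul_exp_le_alphaW
  norm_locCfgY_sub_unshift_le norm_reHolY_imHolY_locCfgY_le len_bounds unitaryLike_locCfgY)
open Literature.MathematicalPhysics.QuantumFieldTheory.Balaban1983to89.B9Cor36CubeCutoffs (SC NearC locCfgY)
open Literature.MathematicalPhysics.QuantumFieldTheory.Balaban1983to89.B9Eq360DeltaPrimeAY (AfldY)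
open Literature.MathematicalPhysics.QuantumFieldTheory.Balaban1983to89.B6GlobalChartV1 (boxEquiv)
open Literature.MathematicalPhysics.QuantumFieldTheory.Balaban1983to89.B9BackgroundsKLevelV1 (shiftsV1)
open Literature.MathematicalPhysics.QuantumFieldTheory.Balaban1983to89.B9Eq39Adjoint (covD)

variable {d ℓ : ℕ} {hd : 1 ≤ d + 1} {hL : Odd (ℓ + 1) ∧ 1 < ℓ + 1} {b₀ b₁ : ℝ}
variable {𝔸 : Type} [NormedRing 𝔸] [NormedAlgebra ℂ 𝔸] [CompleteSpace 𝔸]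
variable (i : KIdx d ℓ hd hL b₀ b₁)

/-! ## §1  Lattice translations: sites, bonds, plaquettes, backgrounds; the translated holonomy and contour data -/

section Translations

/-- `(x + e_a)_j = x_j + [j = a]`. [cite: Balaban1985BackgroundPropagators, (3.3) p.390, bookkeeping] -/
theorem shift_apply (x : Site (PV d ℓ i.m i.K hd hL) 0) (a j : Fin (d + 1)) : (x.shift a) j = if j = a then x j + 1 else x j := by
  unfold Site.shift
  rw [Function.update_apply]
  split_ifs with h
  · subst h; rfl
  · rfl

/-- `(x − e_a)_j = x_j − [j = a]`. [cite: Balaban1985BackgroundPropagators, (3.8) p.392, bookkeeping] -/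
theorem unshift_apply (x : Site (PV d ℓ i.m i.K hd hL) 0) (a j : Fin (d + 1)) : (x.unshift a) j = if j = a then x j - 1 else x j := by
  unfold Site.unshift
  rw [Function.update_apply]
  split_ifs with h
  · subst h; rfl
  · rfl

/-- `(x + e_a) + e_c = (x + e_c) + e_a`. [cite: Balaban1985BackgroundPropagators, (3.3) p.390, bookkeeping] -/
theorem shift_shift_comm (x : Site (PV d ℓ i.m i.K hd hL) 0) (a c : Fin (d + 1)) : (x.shift a).shift c = (x.shift c).shift a := by
  funext j
  simp only [shift_apply]
  split_ifs <;> ring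

/-- `(x − e_a) − e_c = (x − e_c) − e_a`. [cite: Balaban1985BackgroundPropagators, (3.8) p.392, bookkeeping] -/
theorem unshift_unshift_comm (x : Site (PV d ℓ i.m i.K hd hL) 0) (a c : Fin (d + 1)) : (x.unshift a).unshift c = (x.unshift c).unshift a := by
  funext j
  simp only [unshift_apply]
  split_ifs <;> ring

/-- **the translated bond** `b + e_a = ⟨b₋ + e_a, dir b⟩`. [cite: Balaban1985BackgroundPropagators, (3.3) p.390, dictionary] -/
def bshift (a : Fin (d + 1)) (b : FBondY i) : FBondY i := ⟨b.src.shift a, b.dir⟩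

/-- `bshift` is injective. [cite: Balaban1985BackgroundPropagators, (3.3) p.390, bookkeeping] -/
theorem bshift_injective (a : Fin (d + 1)) : Function.Injective (bshift i a) := by
  intro b b' h
  obtain ⟨s, κ⟩ := b
  obtain ⟨s', κ'⟩ := b'
  simp only [bshift, PBond.mk.injEq] at h
  obtain ⟨h1, h2⟩ := h
  have h3 : s = s' := by rw [← unshift_shift i s a, h1, unshift_shift]
  rw [h2, h3]

/-- **the plaquette translation** `p ↦ p + e_a` as a permutation of the plaquettes. [cite: Balaban1985BackgroundPropagators, (3.2) p.390, dictionary] -/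
def plaqShift (a : Fin (d + 1)) : PlaqY i ≃ PlaqY i where
  toFun p := ⟨p.src.shift a, p.μ, p.ν, p.hμν⟩
  invFun p := ⟨p.src.unshift a, p.μ, p.ν, p.hμν⟩
  left_inv p := by cases p; simp only [unshift_shift]
  right_inv p := by cases p; simp only [shift_unshift]

/-- `plaqShift` on the source. [cite: Balaban1985BackgroundPropagators, (3.2) p.390, bookkeeping] -/
@[simp] theorem plaqShift_src (a : Fin (d + 1)) (p : PlaqY i) : (plaqShift i a p).src = p.src.shift a := rfl
/-- `plaqShift` keeps the first direction. [cite: Balaban1985BackgroundPropagators, (3.2) p.390, bookkeeping] -/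
@[simp] theorem plaqShift_μ (a : Fin (d + 1)) (p : PlaqY i) : (plaqShift i a p).μ = p.μ := rfl
/-- `plaqShift` keeps the second direction. [cite: Balaban1985BackgroundPropagators, (3.2) p.390, bookkeeping] -/
@[simp] theorem plaqShift_ν (a : Fin (d + 1)) (p : PlaqY i) : (plaqShift i a p).ν = p.ν := rfl
/-- the inverse translation on the source. [cite: Balaban1985BackgroundPropagators, (3.2) p.390, bookkeeping] -/
@[simp] theorem plaqShift_symm_src (a : Fin (d + 1)) (p : PlaqY i) : ((plaqShift i a).symm p).src = p.src.unshift a := rfl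

/-- **the background read one step back**: `(V⁻ᵃ)_c(y) = V_c(y − e_a)` — translating an operator built from `V` by `e_a` replaces `V` by `V⁻ᵃ`.
[cite: Balaban1985BackgroundPropagators, (3.28) p.395 (translations as gauge-type symmetries of the lattice), dictionary] -/
def unshCfgY (a : Fin (d + 1)) (V : CfgY 𝔸 i) : CfgY 𝔸 i := fun c y => V c (y.unshift a)

/-- `V⁻ᵃ` evaluated. [cite: Balaban1985BackgroundPropagators, (3.28) p.395, bookkeeping] -/
@[simp] theorem unshCfgY_apply (a : Fin (d + 1)) (V : CfgY 𝔸 i) (c : Fin (d + 1)) (y : Site (PV d ℓ i.m i.K hd hL) 0) :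
    unshCfgY i a V c y = V c (y.unshift a) := rfl

/-- the trivial background is translation invariant. [cite: Balaban1985BackgroundPropagators, p.395, bookkeeping] -/
theorem unshCfgY_one (a : Fin (d + 1)) : unshCfgY i a (fun _ _ => (1 : 𝔸ˣ)) = fun _ _ => 1 := rfl

/-- the contour bonds of the translated plaquette are the translated contour bonds. [cite: Balaban1985BackgroundPropagators, (3.2) p.390] -/
theorem edgeY_plaqShift (a : Fin (d + 1)) (p : PlaqY i) (m : Fin 4) : edgeY i (plaqShift i a p) m = bshift i a (edgeY i p m) := by
  fin_cases m
  · show (⟨(p.src.shift a).shift p.ν, p.μ⟩ : FBondY i) = ⟨(p.src.shift p.ν).shift a, p.μ⟩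
    rw [shift_shift_comm]
  · rfl
  · rfl
  · show (⟨(p.src.shift a).shift p.μ, p.ν⟩ : FBondY i) = ⟨(p.src.shift p.μ).shift a, p.ν⟩
    rw [shift_shift_comm]

/-- the contour transporters of `V⁻ᵃ` on the translated plaquette are those of `V`. [cite: Balaban1985BackgroundPropagators, (3.2) p.390] -/
theorem edgeParY_unsh (a : Fin (d + 1)) (V : CfgY 𝔸 i) (p : PlaqY i) (m : Fin 4) :
    edgeParY i (unshCfgY i a V) (plaqShift i a p) m = edgeParY i V p m := by
  fin_cases m
  · show unshCfgY i a V p.ν (p.src.shift a) = V p.ν p.src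
    rw [unshCfgY_apply, unshift_shift]
  · rfl
  · rfl
  · show unshCfgY i a V p.μ (p.src.shift a) = V p.μ p.src
    rw [unshCfgY_apply, unshift_shift]

/-- **the holonomy is translation covariant**: `U⁻ᵃ(∂(p + e_a)) = U(∂p)`. [cite: Balaban1985BackgroundPropagators, (3.1) p.390] -/
theorem holY_unsh (a : Fin (d + 1)) (V : CfgY 𝔸 i) (p : PlaqY i) : holY i (unshCfgY i a V) (plaqShift i a p) = holY i V p := by
  simp only [holY, unshCfgY_apply, plaqShift_src, plaqShift_μ, plaqShift_ν]
  rw [shift_shift_comm i p.src a p.μ, shift_shift_comm i p.src a p.ν, unshift_shift, unshift_shift, unshift_shift]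

/-- `Re U⁻ᵃ(∂(p + e_a)) = Re U(∂p)`. [cite: Balaban1985BackgroundPropagators, (3.7) p.391] -/
theorem reHolY_unsh (a : Fin (d + 1)) (V : CfgY 𝔸 i) (p : PlaqY i) : reHolY i (unshCfgY i a V) (plaqShift i a p) = reHolY i V p := by
  rw [reHolY, reHolY, holY_unsh]

/-- `Im U⁻ᵃ(∂(p + e_a)) = Im U(∂p)`. [cite: Balaban1985BackgroundPropagators, (3.7) p.391] -/
theorem imHolY_unsh (a : Fin (d + 1)) (V : CfgY 𝔸 i) (p : PlaqY i) : imHolY i (unshCfgY i a V) (plaqShift i a p) = imHolY i V p := by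
  rw [imHolY, imHolY, holY_unsh]

/-- `Re U⁻ᵃ(∂p) = Re U(∂(p − e_a))`. [cite: Balaban1985BackgroundPropagators, (3.7) p.391] -/
theorem reHolY_unsh' (a : Fin (d + 1)) (V : CfgY 𝔸 i) (p : PlaqY i) : reHolY i (unshCfgY i a V) p = reHolY i V ((plaqShift i a).symm p) := by
  rw [← reHolY_unsh i a V ((plaqShift i a).symm p), Equiv.apply_symm_apply]

end Translations

/-! ## §2  Translation covariance of the letters: `T_V ∘ σ_a = σ_a ∘ T_{V⁻ᵃ}` for `sel_μ`, `𝒦_V`, `D*_V`, `W_{V,μ}`, `V¹_μ`, `P¹_ν` -/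

section Equivariance

omit [CompleteSpace 𝔸] in
/-- `σ_a X` evaluated (G-F6a's translation of bond functions). [cite: Balaban1985BackgroundPropagators, (3.3) p.390, bookkeeping] -/
theorem shiftOpB_apply' (a : Fin (d + 1)) (X : FBondY i → 𝔸) (f : FBondY i) : shiftOpB i a X f = X (bshift i a f) := rfl

omit [CompleteSpace 𝔸] in
/-- `sel_μ(σ_a Y) = (sel_μ Y) ∘ (· + e_a)`. [cite: Balaban1985BackgroundPropagators, (3.4) p.391] -/
theorem selY_shift (μ a : Fin (d + 1)) (Y : FBondY i → 𝔸) : selY i μ (shiftOpB i a Y) = selY i μ Y ∘ plaqShift i a := by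
  funext p
  rfl

/-- `𝒦_V(F ∘ (· + e_a))(p) = 𝒦_{V⁻ᵃ}F(p + e_a)`. [cite: Balaban1985BackgroundPropagators, (3.10) p.392] -/
theorem jordanY_shift (a : Fin (d + 1)) (V : CfgY 𝔸 i) (F : PlaqY i → 𝔸) (p : PlaqY i) :
    jordanY i V (F ∘ plaqShift i a) p = jordanY i (unshCfgY i a V) F (plaqShift i a p) := by
  rw [jordanY_apply, jordanY_apply, reHolY_unsh, Function.comp_apply]

/-- **the co-curl is translation covariant**: `(D*_V(F ∘ (· + e_a)))(b) = (D*_{V⁻ᵃ}F)(b + e_a)`. [cite: Balaban1985BackgroundPropagators, (3.9) p.392, (3.28) p.395] -/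
theorem coCurlY_shift (a : Fin (d + 1)) (V : CfgY 𝔸 i) (F : PlaqY i → 𝔸) (b : FBondY i) :
    coCurlY i V (F ∘ plaqShift i a) b = coCurlY i (unshCfgY i a V) F (bshift i a b) := by
  classical
  rw [coCurlY_apply_eq_sum_edgeY, coCurlY_apply_eq_sum_edgeY]
  congr 1
  conv_rhs => rw [← Equiv.sum_comp (plaqShift i a)]
  refine Finset.sum_congr rfl fun p _ => Finset.sum_congr rfl fun m _ => ?_
  rw [edgeY_plaqShift, edgeParY_unsh, Function.comp_apply]
  by_cases h : edgeY i p m = b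
  · rw [if_pos h, if_pos (by rw [h])]
  · rw [if_neg h, if_neg (fun h' => h (bshift_injective i a h'))]

/-- **the co-curl∕Jordan difference is translation covariant**: with `Z_V = D*_V𝒦_V − D*₁`, `(Z_V(F ∘ (· + e_a)))(b) = (Z_{V⁻ᵃ}F)(b + e_a)`.
[cite: Balaban1985BackgroundPropagators, (3.71) p.404, (3.9)–(3.10) p.392] -/
theorem coCurlJordan_shift (a : Fin (d + 1)) (V : CfgY 𝔸 i) (F : PlaqY i → 𝔸) (b : FBondY i) :
    ((coCurlY i V ∘ₗ jordanY i V - coCurlY i (fun _ _ => (1 : 𝔸ˣ))) : (PlaqY i → 𝔸) →ₗ[ℂ] (FBondY i → 𝔸)) (F ∘ plaqShift i a) b =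
      ((coCurlY i (unshCfgY i a V) ∘ₗ jordanY i (unshCfgY i a V) - coCurlY i (fun _ _ => (1 : 𝔸ˣ))) : (PlaqY i → 𝔸) →ₗ[ℂ] (FBondY i → 𝔸))
        F (bshift i a b) := by
  rw [LinearMap.sub_apply, LinearMap.sub_apply, Pi.sub_apply, Pi.sub_apply, LinearMap.comp_apply, LinearMap.comp_apply]
  have hJ : jordanY i V (F ∘ plaqShift i a) = jordanY i (unshCfgY i a V) F ∘ plaqShift i a := funext (jordanY_shift i a V F)
  have h1 : coCurlY i (fun _ _ => (1 : 𝔸ˣ)) (F ∘ plaqShift i a) b = coCurlY i (fun _ _ => (1 : 𝔸ˣ)) F (bshift i a b) := coCurlY_shift i a _ F b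
  rw [hJ, coCurlY_shift, h1]

/-- **`W_{V,μ}` is translation covariant**: `(W_{V,μ}(σ_a Y))(b) = (W_{V⁻ᵃ,μ}Y)(b + e_a)`. [cite: Balaban1985BackgroundPropagators, (3.71) p.404] -/
theorem WY_shift (μ a : Fin (d + 1)) (V : CfgY 𝔸 i) (Y : FBondY i → 𝔸) (b : FBondY i) :
    WY i V μ (shiftOpB i a Y) b = WY i (unshCfgY i a V) μ Y (bshift i a b) := by
  rw [WY_apply, WY_apply]
  show (if μ = b.dir then 0 else ((i.cf : ℝ) : ℂ) • ((R (V μ (b.src.unshift μ)) (Y ⟨b.src.shift a, b.dir⟩) - Y ⟨b.src.shift a, b.dir⟩) -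
      (R (V b.dir (b.src.unshift μ)) (Y ⟨((b.src.shift b.dir).unshift μ).shift a, μ⟩) - Y ⟨((b.src.shift b.dir).unshift μ).shift a, μ⟩))) =
    (if μ = b.dir then 0 else ((i.cf : ℝ) : ℂ) • ((R (V μ (((b.src.shift a).unshift μ).unshift a)) (Y ⟨b.src.shift a, b.dir⟩) - Y ⟨b.src.shift a, b.dir⟩) -
      (R (V b.dir (((b.src.shift a).unshift μ).unshift a)) (Y ⟨((b.src.shift a).shift b.dir).unshift μ, μ⟩) - Y ⟨((b.src.shift a).shift b.dir).unshift μ, μ⟩)))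
  have e1 : ((b.src.shift a).unshift μ).unshift a = b.src.unshift μ := by rw [unshift_unshift_comm, unshift_shift]
  have e2 : ((b.src.shift a).shift b.dir).unshift μ = ((b.src.shift b.dir).unshift μ).shift a := by
    rw [shift_shift_comm, unshift_shift_comm]
  rw [e1, e2]

/-- ★ **`V¹_μ` is translation covariant**: `(V¹_{V,μ}(σ_a Y))(b) = (V¹_{V⁻ᵃ,μ}Y)(b + e_a)`. [cite: Balaban1985BackgroundPropagators, (3.71) pp.404–405] -/
theorem V1Y_shift (μ a : Fin (d + 1)) (V : CfgY 𝔸 i) (Y : FBondY i → 𝔸) (b : FBondY i) :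
    V1Y i V μ (shiftOpB i a Y) b = V1Y i (unshCfgY i a V) μ Y (bshift i a b) := by
  rw [V1Y, V1Y, LinearMap.sub_apply, LinearMap.sub_apply, Pi.sub_apply, Pi.sub_apply, WY_shift, LinearMap.comp_apply, LinearMap.comp_apply,
    selY_shift, coCurlJordan_shift]

/-- **`P¹a_ν` is translation covariant**. [cite: Balaban1985BackgroundPropagators, (3.75) p.405] -/
theorem P1aY_shift (ν a : Fin (d + 1)) (V : CfgY 𝔸 i) (Y : FBondY i → 𝔸) (b : FBondY i) :
    P1aY i V ν (shiftOpB i a Y) b = P1aY i (unshCfgY i a V) ν Y (bshift i a b) := by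
  obtain ⟨s, κ⟩ := b
  rw [bshift, P1aY_apply_mk, P1aY_apply_mk, unshCfgY_apply, unshift_shift]
  show ((i.cf : ℝ) : ℂ) • (R (V κ s) (Y ⟨((s.shift κ).unshift ν).shift a, ν⟩) - Y ⟨((s.shift κ).unshift ν).shift a, ν⟩) =
    ((i.cf : ℝ) : ℂ) • (R (V κ s) (Y ⟨((s.shift a).shift κ).unshift ν, ν⟩) - Y ⟨((s.shift a).shift κ).unshift ν, ν⟩)
  rw [unshift_shift_comm, shift_shift_comm i s κ a]

/-- **`P¹b_ν` is translation covariant**. [cite: Balaban1985BackgroundPropagators, (3.75) p.405] -/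
theorem P1bY_shift (ν a : Fin (d + 1)) (V : CfgY 𝔸 i) (Y : FBondY i → 𝔸) (b : FBondY i) :
    P1bY i V ν (shiftOpB i a Y) b = P1bY i (unshCfgY i a V) ν Y (bshift i a b) := by
  obtain ⟨s, κ⟩ := b
  rw [bshift, P1bY_apply_mk, P1bY_apply_mk]
  show (if ν = κ then -(((i.cf : ℝ) : ℂ) • ∑ μ : Fin (d + 1), (R (V μ (s.unshift μ))⁻¹ (Y ⟨(s.unshift μ).shift a, μ⟩) - Y ⟨(s.unshift μ).shift a, μ⟩))
      else 0) =
    (if ν = κ then -(((i.cf : ℝ) : ℂ) • ∑ μ : Fin (d + 1),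
      (R (V μ (((s.shift a).unshift μ).unshift a))⁻¹ (Y ⟨(s.shift a).unshift μ, μ⟩) - Y ⟨(s.shift a).unshift μ, μ⟩)) else 0)
  have e1 : ∀ μ : Fin (d + 1), ((s.shift a).unshift μ).unshift a = s.unshift μ := fun μ => by
    rw [unshift_unshift_comm i (s.shift a) μ a, unshift_shift]
  have e2 : ∀ μ : Fin (d + 1), (s.unshift μ).shift a = (s.shift a).unshift μ := fun μ => unshift_shift_comm i s μ a
  simp only [e1, e2]

/-- ★ **`P¹_ν` is translation covariant**: `(P¹_{V,ν}(σ_a Y))(b) = (P¹_{V⁻ᵃ,ν}Y)(b + e_a)`. [cite: Balaban1985BackgroundPropagators, (3.75) p.405] -/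
theorem P1Y_shift (ν a : Fin (d + 1)) (V : CfgY 𝔸 i) (Y : FBondY i → 𝔸) (b : FBondY i) :
    P1Y i V ν (shiftOpB i a Y) b = P1Y i (unshCfgY i a V) ν Y (bshift i a b) := by
  rw [P1Y, P1Y, LinearMap.add_apply, LinearMap.add_apply, Pi.add_apply, Pi.add_apply, P1aY_shift, P1bY_shift]

omit [CompleteSpace 𝔸] in
/-- ★ **COMMUTATOR WITH THE FLAT DERIVATIVE = `c_f`·(TRANSLATED COEFFICIENT DIFFERENCE)**: if `T₁(σ_a X)(b) = T₂X(b + e_a)` for all `X, b` (translation covariance with the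
translated coefficients `T₂`), then `(T₁∇_a X − ∇_a T₁X)(b) = c_f·((T₂ − T₁)X)(b + e_a)` — the lattice Leibniz rule: the outer difference falls on the coefficients.
[cite: Balaban1985BackgroundPropagators, (3.100) p.413 (lattice product rule), (3.71) p.404, (3.75) p.405] -/
theorem comm_nablaY_apply {T₁ T₂ : (FBondY i → 𝔸) →ₗ[ℂ] (FBondY i → 𝔸)} (a : Fin (d + 1))
    (h : ∀ (X : FBondY i → 𝔸) (b : FBondY i), T₁ (shiftOpB i a X) b = T₂ X (bshift i a b)) (X : FBondY i → 𝔸) (b : FBondY i) :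
    (T₁ ∘ₗ nablaY i a - nablaY i a ∘ₗ T₁) X b = ((i.cf : ℝ) : ℂ) • ((T₂ - T₁) X (bshift i a b)) := by
  have hN : nablaY i a X = ((i.cf : ℝ) : ℂ) • (shiftOpB i a X - X) := by
    funext f
    rw [nablaY_apply, Pi.smul_apply, Pi.sub_apply, shiftOpB_apply']
    rfl
  rw [LinearMap.sub_apply, Pi.sub_apply, LinearMap.comp_apply, LinearMap.comp_apply, hN, map_smul, map_sub, nablaY_apply, Pi.smul_apply,
    Pi.sub_apply, h, LinearMap.sub_apply, Pi.sub_apply, ← smul_sub]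
  congr 1
  show T₂ X (bshift i a b) - T₁ X b - (T₁ X (bshift i a b) - T₁ X b) = T₂ X (bshift i a b) - T₁ X (bshift i a b)
  abel

end Equivariance

/-! ## §3  Lipschitz dependence of the letters on the background: `‖(T_{V′} − T_V)Y(b)‖ ≤ O(1)·(window of `V′ − V`)·sup|Y|` -/

section Lipschitz

variable {V V' : CfgY 𝔸 i} (hU : ∀ μ x, ‖(V μ x : 𝔸)‖ ≤ 1 ∧ ‖(((V μ x)⁻¹ : 𝔸ˣ) : 𝔸)‖ ≤ 1)
  (hU' : ∀ μ x, ‖(V' μ x : 𝔸)‖ ≤ 1 ∧ ‖(((V' μ x)⁻¹ : 𝔸ˣ) : 𝔸)‖ ≤ 1)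
include hU hU'

/-- ★ **`W_{V′,μ} − W_{V,μ}` at a bond `b = ⟨x, κ⟩`**: with `‖V′_a(x − e_μ) − V_a(x − e_μ)‖ ≤ ω` (all `a`) and `‖Y‖ ≤ s` at `b` and at `⟨x+e_κ−e_μ, μ⟩`:
`‖(W_{V′,μ}Y − W_{V,μ}Y)(b)‖ ≤ |c_f|·4ω·s` (`‖R(u)w − R(u′)w‖ ≤ 2‖u − u′‖‖w‖`). [cite: Balaban1985BackgroundPropagators, (3.71) p.404, (3.73) p.405 (the `|∇A||A′|` term), (3.100) p.413] -/
theorem norm_WY_sub_apply_le (μ : Fin (d + 1)) (b : FBondY i) {ω s : ℝ} (hs : 0 ≤ s) (hω : 0 ≤ ω)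
    (hW : ∀ a : Fin (d + 1), ‖(V' a (b.src.unshift μ) : 𝔸) - V a (b.src.unshift μ)‖ ≤ ω)
    (Y : FBondY i → 𝔸) (hY : ‖Y b‖ ≤ s ∧ ‖Y ⟨(b.src.shift b.dir).unshift μ, μ⟩‖ ≤ s) :
    ‖WY i V' μ Y b - WY i V μ Y b‖ ≤ |i.cf| * (4 * ω * s) := by
  rw [WY_apply, WY_apply]
  split_ifs with h
  · rw [sub_zero, norm_zero]; positivity
  · rw [← smul_sub, norm_smul, Complex.norm_real, Real.norm_eq_abs]
    refine mul_le_mul_of_nonneg_left ?_ (abs_nonneg _)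
    have e : R (V' μ (b.src.unshift μ)) (Y b) - Y b - (R (V' b.dir (b.src.unshift μ)) (Y ⟨(b.src.shift b.dir).unshift μ, μ⟩) - Y ⟨(b.src.shift b.dir).unshift μ, μ⟩) -
        (R (V μ (b.src.unshift μ)) (Y b) - Y b - (R (V b.dir (b.src.unshift μ)) (Y ⟨(b.src.shift b.dir).unshift μ, μ⟩) - Y ⟨(b.src.shift b.dir).unshift μ, μ⟩)) =
      (R (V' μ (b.src.unshift μ)) (Y b) - R (V μ (b.src.unshift μ)) (Y b)) -
        (R (V' b.dir (b.src.unshift μ)) (Y ⟨(b.src.shift b.dir).unshift μ, μ⟩) - R (V b.dir (b.src.unshift μ)) (Y ⟨(b.src.shift b.dir).unshift μ, μ⟩)) := by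
      abel
    rw [e]
    refine (norm_sub_le _ _).trans ?_
    have t1 := norm_R_sub_R_le (hU' μ (b.src.unshift μ)) (hU μ (b.src.unshift μ)) (Y b)
    have t2 := norm_R_sub_R_le (hU' b.dir (b.src.unshift μ)) (hU b.dir (b.src.unshift μ)) (Y ⟨(b.src.shift b.dir).unshift μ, μ⟩)
    have w1 := hW μ
    have w2 := hW b.dir
    nlinarith [norm_nonneg ((V' μ (b.src.unshift μ) : 𝔸) - V μ (b.src.unshift μ)), norm_nonneg ((V' b.dir (b.src.unshift μ) : 𝔸) - V b.dir (b.src.unshift μ)),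
      norm_nonneg (Y b), norm_nonneg (Y ⟨(b.src.shift b.dir).unshift μ, μ⟩), mul_nonneg hω hs, hY.1, hY.2]

omit hU hU' in
/-- the Jordan insertions of two backgrounds differ by the holonomy window: `‖(𝒦_{V′}F − 𝒦_VF)(p)‖ ≤ ‖Re U′(∂p) − Re U(∂p)‖·‖F(p)‖`.
[cite: Balaban1985BackgroundPropagators, (3.7) p.391, (3.10) p.392] -/
theorem norm_jordanY_sub_jordanY_le (F : PlaqY i → 𝔸) (p : PlaqY i) :
    ‖jordanY i V' F p - jordanY i V F p‖ ≤ ‖reHolY i V' p - reHolY i V p‖ * ‖F p‖ := by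
  rw [jordanY_apply, jordanY_apply, ← smul_sub]
  have e : F p * reHolY i V' p + reHolY i V' p * F p - (F p * reHolY i V p + reHolY i V p * F p) =
      F p * (reHolY i V' p - reHolY i V p) + (reHolY i V' p - reHolY i V p) * F p := by
    simp only [mul_sub, sub_mul]; abel
  rw [e, norm_smul]
  have hn : ‖(1 / 2 : ℂ)‖ = 1 / 2 := by simp
  rw [hn]
  have t := norm_add_le (F p * (reHolY i V' p - reHolY i V p)) ((reHolY i V' p - reHolY i V p) * F p)
  have t1 := norm_mul_le (F p) (reHolY i V' p - reHolY i V p)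
  have t2 := norm_mul_le (reHolY i V' p - reHolY i V p) (F p)
  nlinarith [norm_nonneg (F p), norm_nonneg (reHolY i V' p - reHolY i V p)]

/-- ★ **THE CO-CURL∕JORDAN OPERATORS OF TWO BACKGROUNDS, AT A BOND**: with `‖V′ − V‖ ≤ ω` at the sources of the plaquettes through `b`, `‖Re U′(∂p) − 1‖ ≤ ω₃`,
`‖Re U′(∂p) − Re U(∂p)‖ ≤ ω_H` there and `‖F(p)‖ ≤ s` there: `‖(D*_{V′}𝒦_{V′}F − D*_V𝒦_VF)(b)‖ ≤ |c_f|·4(d+1)·(2ω(1 + ω₃) + ω_H)·s` (variation of the inverse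
contour transporters on `𝒦_{V′}F`, plus the Jordan difference). [cite: Balaban1985BackgroundPropagators, (3.71) p.404, (3.73) p.405, (3.9)–(3.10) p.392] -/
theorem norm_coCurlJordan_diff_apply_le (b : FBondY i) {ω ω₃ ωH s : ℝ} (hs : 0 ≤ s) (hω : 0 ≤ ω) (hω₃ : 0 ≤ ω₃) (hωH : 0 ≤ ωH)
    (hW : ∀ (p : PlaqY i) (m : Fin 4), edgeY i p m = b → ∀ a : Fin (d + 1), ‖(V' a p.src : 𝔸) - V a p.src‖ ≤ ω)
    (hW3 : ∀ (p : PlaqY i) (m : Fin 4), edgeY i p m = b → ‖reHolY i V' p - 1‖ ≤ ω₃)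
    (hH : ∀ (p : PlaqY i) (m : Fin 4), edgeY i p m = b → ‖reHolY i V' p - reHolY i V p‖ ≤ ωH)
    (F : PlaqY i → 𝔸) (hF : ∀ (p : PlaqY i) (m : Fin 4), edgeY i p m = b → ‖F p‖ ≤ s) :
    ‖((coCurlY i V' ∘ₗ jordanY i V' - coCurlY i (fun _ _ => (1 : 𝔸ˣ))) : (PlaqY i → 𝔸) →ₗ[ℂ] (FBondY i → 𝔸)) F b -
        ((coCurlY i V ∘ₗ jordanY i V - coCurlY i (fun _ _ => (1 : 𝔸ˣ))) : (PlaqY i → 𝔸) →ₗ[ℂ] (FBondY i → 𝔸)) F b‖ ≤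
      |i.cf| * (4 * ((d : ℝ) + 1) * ((2 * ω * (1 + ω₃) + ωH) * s)) := by
  classical
  have e0 : ((coCurlY i V' ∘ₗ jordanY i V' - coCurlY i (fun _ _ => (1 : 𝔸ˣ))) : (PlaqY i → 𝔸) →ₗ[ℂ] (FBondY i → 𝔸)) F b -
        ((coCurlY i V ∘ₗ jordanY i V - coCurlY i (fun _ _ => (1 : 𝔸ˣ))) : (PlaqY i → 𝔸) →ₗ[ℂ] (FBondY i → 𝔸)) F b =
      coCurlY i V' (jordanY i V' F) b - coCurlY i V (jordanY i V F) b := by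
    simp only [LinearMap.sub_apply, LinearMap.comp_apply, Pi.sub_apply]; abel
  rw [e0, coCurlY_apply_eq_sum_edgeY, coCurlY_apply_eq_sum_edgeY, ← smul_sub, ← Finset.sum_sub_distrib, norm_smul, Complex.norm_real,
    Real.norm_eq_abs]
  refine mul_le_mul_of_nonneg_left ?_ (abs_nonneg _)
  have key : ∀ p : PlaqY i, ‖(∑ m : Fin 4, (if edgeY i p m = b then sgnY m • R (edgeParY i V' p m)⁻¹ (jordanY i V' F p) else 0)) -
      ∑ m : Fin 4, (if edgeY i p m = b then sgnY m • R (edgeParY i V p m)⁻¹ (jordanY i V F p) else 0)‖ ≤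
      ∑ m : Fin 4, (if edgeY i p m = b then (1 : ℝ) else 0) * ((2 * ω * (1 + ω₃) + ωH) * s) := by
    intro p
    rw [← Finset.sum_sub_distrib]
    refine norm_sum_le_of_le _ fun m _ => ?_
    split_ifs with h
    · rw [one_mul, ← smul_sub, norm_smul, norm_sgnY, one_mul]
      have eq : R (edgeParY i V' p m)⁻¹ (jordanY i V' F p) - R (edgeParY i V p m)⁻¹ (jordanY i V F p) =
          (R (edgeParY i V' p m)⁻¹ (jordanY i V' F p) - R (edgeParY i V p m)⁻¹ (jordanY i V' F p)) +
            R (edgeParY i V p m)⁻¹ (jordanY i V' F p - jordanY i V F p) := by rw [R_sub]; abel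
      rw [eq]
      refine (norm_add_le _ _).trans ?_
      have hJ' : ‖jordanY i V' F p‖ ≤ (1 + ω₃) * s := by
        have h1 := norm_jordanY_sub_le i (V := V') F p
        have h2 : ‖jordanY i V' F p‖ ≤ ‖F p‖ + ‖jordanY i V' F p - F p‖ := by
          have := norm_add_le (F p) (jordanY i V' F p - F p); rwa [add_sub_cancel] at this
        have h3 := hW3 p m h
        have h4 := hF p m h
        nlinarith [norm_nonneg (reHolY i V' p - 1), norm_nonneg (F p)]
      have hgen : ∀ u u' : 𝔸ˣ, (‖(u : 𝔸)‖ ≤ 1 ∧ ‖((u⁻¹ : 𝔸ˣ) : 𝔸)‖ ≤ 1) → (‖(u' : 𝔸)‖ ≤ 1 ∧ ‖((u'⁻¹ : 𝔸ˣ) : 𝔸)‖ ≤ 1) → ‖(u : 𝔸) - u'‖ ≤ ω →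
          ‖R u⁻¹ (jordanY i V' F p) - R u'⁻¹ (jordanY i V' F p)‖ ≤ 2 * ω * ((1 + ω₃) * s) := by
        intro u u' hu hu' hw
        refine (norm_Rinv_sub_Rinv_le hu hu' _).trans ?_
        have := norm_nonneg ((u : 𝔸) - u')
        nlinarith [norm_nonneg (jordanY i V' F p), mul_nonneg hω (mul_nonneg (by linarith : (0 : ℝ) ≤ 1 + ω₃) hs)]
      have t1 : ‖R (edgeParY i V' p m)⁻¹ (jordanY i V' F p) - R (edgeParY i V p m)⁻¹ (jordanY i V' F p)‖ ≤ 2 * ω * ((1 + ω₃) * s) := by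
        have hz : (0 : ℝ) ≤ 2 * ω * ((1 + ω₃) * s) := by positivity
        fin_cases m
        · exact hgen _ _ (hU' p.ν p.src) (hU p.ν p.src) (hW p _ h p.ν)
        · show ‖R (1 : 𝔸ˣ)⁻¹ (jordanY i V' F p) - R (1 : 𝔸ˣ)⁻¹ (jordanY i V' F p)‖ ≤ _
          rw [sub_self, norm_zero]; exact hz
        · show ‖R (1 : 𝔸ˣ)⁻¹ (jordanY i V' F p) - R (1 : 𝔸ˣ)⁻¹ (jordanY i V' F p)‖ ≤ _
          rw [sub_self, norm_zero]; exact hz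
        · exact hgen _ _ (hU' p.μ p.src) (hU p.μ p.src) (hW p _ h p.μ)
      have t2 : ‖R (edgeParY i V p m)⁻¹ (jordanY i V' F p - jordanY i V F p)‖ ≤ ωH * s :=
        ((norm_R_edgeParY_le i V hU p m _).2).trans ((norm_jordanY_sub_jordanY_le i F p).trans (mul_le_mul (hH p m h) (hF p m h) (norm_nonneg _) hωH))
      nlinarith
    · rw [sub_self, norm_zero, zero_mul]
  calc ‖∑ p : PlaqY i, _‖ ≤ ∑ p : PlaqY i, ∑ m : Fin 4, (if edgeY i p m = b then (1 : ℝ) else 0) * ((2 * ω * (1 + ω₃) + ωH) * s) :=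
        norm_sum_le_of_le _ fun p _ => key p
    _ = (∑ p : PlaqY i, ∑ m : Fin 4, (if edgeY i p m = b then (1 : ℝ) else 0)) * ((2 * ω * (1 + ω₃) + ωH) * s) := by
        rw [Finset.sum_mul]; refine Finset.sum_congr rfl fun p _ => ?_; rw [Finset.sum_mul]
    _ ≤ 4 * ((d : ℝ) + 1) * ((2 * ω * (1 + ω₃) + ωH) * s) := by
        refine mul_le_mul_of_nonneg_right (sum_edge_indicator_le i b) ?_; positivity

/-- ★★ **LIPSCHITZ DEPENDENCE OF THE FIRST-ORDER WORDS `V¹_μ` ON THE BACKGROUND, AT A BOND `b = ⟨x, κ⟩`** (raw stencil form): with `‖V′ − V‖ ≤ ω` at `x − e_μ` and at the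
sources of the plaquettes through `b`, `‖Re U′(∂p) − 1‖ ≤ ω₃`, `‖Re U′(∂p) − Re U(∂p)‖ ≤ ω_H` there, and `‖Y‖ ≤ s` on the stencil:
`‖(V¹_{V′,μ}Y − V¹_{V,μ}Y)(b)‖ ≤ |c_f|·(4ω + 8(d+1)(2ω(1+ω₃) + ω_H))·s`. [cite: Balaban1985BackgroundPropagators, (3.71) pp.404–405, (3.73) p.405] -/
theorem norm_V1Y_sub_apply_le (μ : Fin (d + 1)) (b : FBondY i) {ω ω₃ ωH s : ℝ} (hs : 0 ≤ s) (hω : 0 ≤ ω) (hω₃ : 0 ≤ ω₃) (hωH : 0 ≤ ωH)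
    (hWμ : ∀ a : Fin (d + 1), ‖(V' a (b.src.unshift μ) : 𝔸) - V a (b.src.unshift μ)‖ ≤ ω)
    (hWp : ∀ (p : PlaqY i) (m : Fin 4), edgeY i p m = b → ∀ a : Fin (d + 1), ‖(V' a p.src : 𝔸) - V a p.src‖ ≤ ω)
    (hW3 : ∀ (p : PlaqY i) (m : Fin 4), edgeY i p m = b → ‖reHolY i V' p - 1‖ ≤ ω₃)
    (hH : ∀ (p : PlaqY i) (m : Fin 4), edgeY i p m = b → ‖reHolY i V' p - reHolY i V p‖ ≤ ωH)
    (Y : FBondY i → 𝔸) (hYb : ‖Y b‖ ≤ s ∧ ‖Y ⟨(b.src.shift b.dir).unshift μ, μ⟩‖ ≤ s)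
    (hYp : ∀ (p : PlaqY i) (m : Fin 4), edgeY i p m = b → ‖Y ⟨p.src, p.ν⟩‖ ≤ s ∧ ‖Y ⟨p.src, p.μ⟩‖ ≤ s) :
    ‖V1Y i V' μ Y b - V1Y i V μ Y b‖ ≤ |i.cf| * ((4 * ω + 8 * ((d : ℝ) + 1) * (2 * ω * (1 + ω₃) + ωH)) * s) := by
  have e : V1Y i V' μ Y b - V1Y i V μ Y b = (WY i V' μ Y b - WY i V μ Y b) -
      (((coCurlY i V' ∘ₗ jordanY i V' - coCurlY i (fun _ _ => (1 : 𝔸ˣ))) : (PlaqY i → 𝔸) →ₗ[ℂ] (FBondY i → 𝔸)) (selY i μ Y) b -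
        ((coCurlY i V ∘ₗ jordanY i V - coCurlY i (fun _ _ => (1 : 𝔸ˣ))) : (PlaqY i → 𝔸) →ₗ[ℂ] (FBondY i → 𝔸)) (selY i μ Y) b) := by
    simp only [V1Y, LinearMap.sub_apply, Pi.sub_apply, LinearMap.comp_apply]; abel
  rw [e]
  refine (norm_sub_le _ _).trans ?_
  have t1 := norm_WY_sub_apply_le i hU hU' μ b hs hω hWμ Y hYb
  have t2 := norm_coCurlJordan_diff_apply_le i hU hU' b (s := 2 * s) (by positivity) hω hω₃ hωH hWp hW3 hH (selY i μ Y)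
    (fun p m h => norm_selY_apply_le i μ p Y (hYp p m h))
  have e2 : |i.cf| * ((4 * ω + 8 * ((d : ℝ) + 1) * (2 * ω * (1 + ω₃) + ωH)) * s) =
      |i.cf| * (4 * ω * s) + |i.cf| * (4 * ((d : ℝ) + 1) * ((2 * ω * (1 + ω₃) + ωH) * (2 * s))) := by ring
  rw [e2]
  exact add_le_add t1 t2

/-- ★★ **LIPSCHITZ DEPENDENCE OF `P¹_ν` ON THE BACKGROUND, AT A BOND `b = ⟨s, κ⟩`** (raw stencil form): with `‖V′_κ(s) − V_κ(s)‖ ≤ ω`, `‖V′_μ(s−e_μ) − V_μ(s−e_μ)‖ ≤ ω`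
(all `μ`) and `‖Y‖ ≤ t` on the stencil: `‖(P¹_{V′,ν}Y − P¹_{V,ν}Y)(b)‖ ≤ |c_f|·2(d+2)·ω·t`. [cite: Balaban1985BackgroundPropagators, (3.75) p.405, (3.73) p.405] -/
theorem norm_P1Y_sub_apply_le (ν : Fin (d + 1)) (s : Site (PV d ℓ i.m i.K hd hL) 0) (κ : Fin (d + 1)) {ω t : ℝ} (ht : 0 ≤ t) (hω : 0 ≤ ω)
    (hWκ : ‖(V' κ s : 𝔸) - V κ s‖ ≤ ω) (hWμ : ∀ μ : Fin (d + 1), ‖(V' μ (s.unshift μ) : 𝔸) - V μ (s.unshift μ)‖ ≤ ω)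
    (Y : FBondY i → 𝔸) (hY1 : ‖Y ⟨(s.shift κ).unshift ν, ν⟩‖ ≤ t) (hY2 : ∀ μ : Fin (d + 1), ‖Y ⟨s.unshift μ, μ⟩‖ ≤ t) :
    ‖P1Y i V' ν Y ⟨s, κ⟩ - P1Y i V ν Y ⟨s, κ⟩‖ ≤ |i.cf| * (cP1 d * ω * t) := by
  have e : P1Y i V' ν Y ⟨s, κ⟩ - P1Y i V ν Y ⟨s, κ⟩ = (P1aY i V' ν Y ⟨s, κ⟩ - P1aY i V ν Y ⟨s, κ⟩) + (P1bY i V' ν Y ⟨s, κ⟩ - P1bY i V ν Y ⟨s, κ⟩) := by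
    simp only [P1Y, LinearMap.add_apply, Pi.add_apply]; abel
  rw [e]
  refine (norm_add_le _ _).trans ?_
  have t1 : ‖P1aY i V' ν Y ⟨s, κ⟩ - P1aY i V ν Y ⟨s, κ⟩‖ ≤ |i.cf| * (2 * ω * t) := by
    rw [P1aY_apply_mk, P1aY_apply_mk, ← smul_sub, norm_smul, Complex.norm_real, Real.norm_eq_abs]
    refine mul_le_mul_of_nonneg_left ?_ (abs_nonneg _)
    have e1 : R (V' κ s) (Y ⟨(s.shift κ).unshift ν, ν⟩) - Y ⟨(s.shift κ).unshift ν, ν⟩ - (R (V κ s) (Y ⟨(s.shift κ).unshift ν, ν⟩) - Y ⟨(s.shift κ).unshift ν, ν⟩) =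
        R (V' κ s) (Y ⟨(s.shift κ).unshift ν, ν⟩) - R (V κ s) (Y ⟨(s.shift κ).unshift ν, ν⟩) := by abel
    rw [e1]
    have h := norm_R_sub_R_le (hU' κ s) (hU κ s) (Y ⟨(s.shift κ).unshift ν, ν⟩)
    nlinarith [norm_nonneg ((V' κ s : 𝔸) - V κ s), norm_nonneg (Y ⟨(s.shift κ).unshift ν, ν⟩)]
  have t2 : ‖P1bY i V' ν Y ⟨s, κ⟩ - P1bY i V ν Y ⟨s, κ⟩‖ ≤ |i.cf| * (((d : ℝ) + 1) * (2 * ω * t)) := by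
    rw [P1bY_apply_mk, P1bY_apply_mk]
    split_ifs with h
    · rw [← neg_sub_neg, neg_neg, neg_neg, ← smul_sub, ← Finset.sum_sub_distrib, norm_smul, Complex.norm_real, Real.norm_eq_abs]
      refine mul_le_mul_of_nonneg_left ?_ (abs_nonneg _)
      calc ‖∑ μ : Fin (d + 1), _‖ ≤ ∑ μ : Fin (d + 1), (2 * ω * t) := norm_sum_le_of_le _ fun μ _ => ?_
        _ = ((d : ℝ) + 1) * (2 * ω * t) := by rw [Finset.sum_const, Finset.card_univ, Fintype.card_fin, nsmul_eq_mul]; push_cast; ring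
      have e1 : R (V μ (s.unshift μ))⁻¹ (Y ⟨s.unshift μ, μ⟩) - Y ⟨s.unshift μ, μ⟩ - (R (V' μ (s.unshift μ))⁻¹ (Y ⟨s.unshift μ, μ⟩) - Y ⟨s.unshift μ, μ⟩) =
          R (V μ (s.unshift μ))⁻¹ (Y ⟨s.unshift μ, μ⟩) - R (V' μ (s.unshift μ))⁻¹ (Y ⟨s.unshift μ, μ⟩) := by abel
      rw [e1]
      have h1 := norm_Rinv_sub_Rinv_le (hU μ (s.unshift μ)) (hU' μ (s.unshift μ)) (Y ⟨s.unshift μ, μ⟩)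
      have w1 := hWμ μ
      rw [norm_sub_rev] at w1
      have y1 := hY2 μ
      nlinarith [norm_nonneg ((V μ (s.unshift μ) : 𝔸) - V' μ (s.unshift μ)), norm_nonneg (Y ⟨s.unshift μ, μ⟩)]
    · rw [sub_zero, norm_zero]; positivity
  have e2 : |i.cf| * (cP1 d * ω * t) = |i.cf| * (2 * ω * t) + |i.cf| * (((d : ℝ) + 1) * (2 * ω * t)) := by rw [cP1]; ring
  rw [e2]
  exact add_le_add t1 t2

end Lipschitz

/-! ## §4  ★★ The commutators `[V¹_μ, ∇_ν]`, `[P¹_μ, ∇_ν]` at a bond: zeroth order, of (3.73)∕(3.37) size `c_f²·O(1)·(ω₂ + ω₃)·sup|X|` -/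

section Commutators

variable (q : ↥(cubes (toKT i).D.toDomains))
variable {V : CfgY 𝔸 i} (hU : ∀ μ x, ‖(V μ x : 𝔸)‖ ≤ 1 ∧ ‖(((V μ x)⁻¹ : 𝔸ˣ) : 𝔸)‖ ≤ 1)
include hU

/-- ★★ **`[V¹_μ, ∇_ν]` AT A BOND `b`**: with the VARIATION window `‖V_a(y − e_ν) − V_a(y)‖ ≤ ω₂` and the plaquette window `‖Re U(∂p) − 1‖ ≤ ω₃` at every site ∕ plaquette
whose block is within graph distance `3` of the block of `b`, and `‖X‖ ≤ s` there:
`‖(V¹_{V,μ}∇_νX − ∇_νV¹_{V,μ}X)(b)‖ ≤ c_f²·(4ω₂ + 8(d+1)(2ω₂(1+ω₃) + 2ω₃))·s` — the outer difference falls on the coefficients (lattice Leibniz rule); print's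
remark that `V₃(A)` is a first-order operator with the bound (3.73), read against the right entry. [cite: Balaban1985BackgroundPropagators, (3.71) pp.404–405, (3.73) p.405, (3.37) p.396, (3.100) p.413, p.407 («V₃(A) is a local differential operator of the first order»)] -/
theorem norm_commV1Y_apply_le (μ ν : Fin (d + 1)) (b : FBondY i) {ω₂ ω₃ s : ℝ} (hs : 0 ≤ s) (hω₂ : 0 ≤ ω₂) (hω₃ : 0 ≤ ω₃)
    (hW2 : ∀ (a : Fin (d + 1)) (y : Site (PV d ℓ i.m i.K hd hL) 0), dSite i q (blkCubeY i q (chartY i b.src)) y ≤ 3 → ‖(V a (y.unshift ν) : 𝔸) - V a y‖ ≤ ω₂)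
    (hW3 : ∀ p : PlaqY i, dSite i q (blkCubeY i q (chartY i b.src)) p.src ≤ 3 → ‖reHolY i V p - 1‖ ≤ ω₃)
    (X : FBondY i → 𝔸) (hX : ∀ e : FBondY i, dSite i q (blkCubeY i q (chartY i b.src)) e.src ≤ 3 → ‖X e‖ ≤ s) :
    ‖(V1Y i V μ ∘ₗ nablaY i ν - nablaY i ν ∘ₗ V1Y i V μ) X b‖ ≤
      |i.cf| * (|i.cf| * ((4 * ω₂ + 8 * ((d : ℝ) + 1) * (2 * ω₂ * (1 + ω₃) + 2 * ω₃)) * s)) := by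
  rw [comm_nablaY_apply i ν (fun X b => V1Y_shift i μ ν V X b), norm_smul, Complex.norm_real, Real.norm_eq_abs, LinearMap.sub_apply, Pi.sub_apply]
  refine mul_le_mul_of_nonneg_left ?_ (abs_nonneg _)
  -- block-graph bookkeeping around `b + e_ν`
  have h0 := dSite_self i q b.src
  have hsh := fun (y : Site (PV d ℓ i.m i.K hd hL) 0) (a : Fin (d + 1)) => dSite_shift_le i q (blkCubeY i q (chartY i b.src)) y a
  have d1 : dSite i q (blkCubeY i q (chartY i b.src)) (b.src.shift ν) ≤ 1 := by linarith [(hsh b.src ν).1]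
  have hp : ∀ (p : PlaqY i) (m : Fin 4), edgeY i p m = bshift i ν b → dSite i q (blkCubeY i q (chartY i b.src)) p.src ≤ 2 := by
    intro p m h
    rcases plaq_src_of_edgeY i h with e | e | e
    · rw [e]; show dSite i q (blkCubeY i q (chartY i b.src)) (b.src.shift ν) ≤ 2; linarith
    · rw [e]; show dSite i q (blkCubeY i q (chartY i b.src)) ((b.src.shift ν).unshift p.ν) ≤ 2; linarith [(hsh (b.src.shift ν) p.ν).2]
    · rw [e]; show dSite i q (blkCubeY i q (chartY i b.src)) ((b.src.shift ν).unshift p.μ) ≤ 2; linarith [(hsh (b.src.shift ν) p.μ).2]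
  have hU' : ∀ a y, ‖(unshCfgY i ν V a y : 𝔸)‖ ≤ 1 ∧ ‖(((unshCfgY i ν V a y)⁻¹ : 𝔸ˣ) : 𝔸)‖ ≤ 1 := fun a y => hU a _
  refine norm_V1Y_sub_apply_le i hU hU' μ (bshift i ν b) hs hω₂ hω₃ (by positivity : (0 : ℝ) ≤ 2 * ω₃) ?_ ?_ ?_ ?_ X ?_ ?_
  · intro a
    exact hW2 a _ (by show dSite i q (blkCubeY i q (chartY i b.src)) ((b.src.shift ν).unshift μ) ≤ 3; linarith [(hsh (b.src.shift ν) μ).2])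
  · intro p m h a
    exact hW2 a _ ((hp p m h).trans (by norm_num))
  · intro p m h
    rw [reHolY_unsh']
    exact hW3 _ (by show dSite i q (blkCubeY i q (chartY i b.src)) (p.src.unshift ν) ≤ 3; linarith [(hsh p.src ν).2, hp p m h])
  · intro p m h
    rw [reHolY_unsh']
    have h1 := hW3 ((plaqShift i ν).symm p) (by show dSite i q (blkCubeY i q (chartY i b.src)) (p.src.unshift ν) ≤ 3; linarith [(hsh p.src ν).2, hp p m h])
    have h2 := hW3 p ((hp p m h).trans (by norm_num))
    have e : reHolY i V ((plaqShift i ν).symm p) - reHolY i V p = (reHolY i V ((plaqShift i ν).symm p) - 1) - (reHolY i V p - 1) := by abel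
    rw [e]
    exact (norm_sub_le _ _).trans (by linarith)
  · exact ⟨hX _ (d1.trans (by norm_num)), hX _ (by
      show dSite i q (blkCubeY i q (chartY i b.src)) (((b.src.shift ν).shift b.dir).unshift μ) ≤ 3
      linarith [(hsh (b.src.shift ν) b.dir).1, (hsh ((b.src.shift ν).shift b.dir) μ).2])⟩
  · intro p m h
    exact ⟨hX _ ((hp p m h).trans (by norm_num)), hX _ ((hp p m h).trans (by norm_num))⟩

/-- ★★ **`[P¹_μ, ∇_ν]` AT A BOND `b`**: with the variation window `‖V_a(y − e_ν) − V_a(y)‖ ≤ ω₂` in the distance-3 block neighbourhood and `‖X‖ ≤ s` there: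
`‖(P¹_{V,μ}∇_νX − ∇_νP¹_{V,μ}X)(b)‖ ≤ c_f²·2(d+2)·ω₂·s`. [cite: Balaban1985BackgroundPropagators, (3.75) p.405, (3.73) p.405, (3.37) p.396, (3.100) p.413] -/
theorem norm_commP1Y_apply_le (μ ν : Fin (d + 1)) (b : FBondY i) {ω₂ s : ℝ} (hs : 0 ≤ s) (hω₂ : 0 ≤ ω₂)
    (hW2 : ∀ (a : Fin (d + 1)) (y : Site (PV d ℓ i.m i.K hd hL) 0), dSite i q (blkCubeY i q (chartY i b.src)) y ≤ 3 → ‖(V a (y.unshift ν) : 𝔸) - V a y‖ ≤ ω₂)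
    (X : FBondY i → 𝔸) (hX : ∀ e : FBondY i, dSite i q (blkCubeY i q (chartY i b.src)) e.src ≤ 3 → ‖X e‖ ≤ s) :
    ‖(P1Y i V μ ∘ₗ nablaY i ν - nablaY i ν ∘ₗ P1Y i V μ) X b‖ ≤ |i.cf| * (|i.cf| * (cP1 d * ω₂ * s)) := by
  rw [comm_nablaY_apply i ν (fun X b => P1Y_shift i μ ν V X b), norm_smul, Complex.norm_real, Real.norm_eq_abs, LinearMap.sub_apply, Pi.sub_apply]
  refine mul_le_mul_of_nonneg_left ?_ (abs_nonneg _)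
  obtain ⟨x, κ⟩ := b
  have hsh := fun (y : Site (PV d ℓ i.m i.K hd hL) 0) (a : Fin (d + 1)) => dSite_shift_le i q (blkCubeY i q (chartY i x)) y a
  have h0 := dSite_self i q x
  have d1 : dSite i q (blkCubeY i q (chartY i x)) (x.shift ν) ≤ 1 := by linarith [(hsh x ν).1]
  have hU' : ∀ a y, ‖(unshCfgY i ν V a y : 𝔸)‖ ≤ 1 ∧ ‖(((unshCfgY i ν V a y)⁻¹ : 𝔸ˣ) : 𝔸)‖ ≤ 1 := fun a y => hU a _
  refine norm_P1Y_sub_apply_le i hU hU' μ (x.shift ν) κ hs hω₂ ?_ ?_ X ?_ ?_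
  · exact hW2 κ _ (d1.trans (by norm_num))
  · intro a
    exact hW2 a _ (by show dSite i q (blkCubeY i q (chartY i x)) ((x.shift ν).unshift a) ≤ 3; linarith [(hsh (x.shift ν) a).2])
  · exact hX _ (by
      show dSite i q (blkCubeY i q (chartY i x)) (((x.shift ν).shift κ).unshift μ) ≤ 3
      linarith [(hsh (x.shift ν) κ).1, (hsh ((x.shift ν).shift κ) μ).2])
  · intro a
    exact hX _ (by show dSite i q (blkCubeY i q (chartY i x)) ((x.shift ν).unshift a) ≤ 3; linarith [(hsh (x.shift ν) a).2])

end Commutators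

/-! ## §5  ★★★ REALIFIED over r05's cube geometry: the commutator letters `conj b(V¹_μ)·DK ν − DK ν·conj b(V¹_μ)` (and `P¹`) have (3.73)-shaped ZEROTH-ORDER majorants -/

section Majorant

variable (q : ↥(cubes (toKT i).D.toDomains))
variable {ιb : Type} [Fintype ιb] (b : Module.Basis ιb ℝ 𝔸)

omit [CompleteSpace 𝔸] in
/-- the realified commutator is the commutator of the realified letters (`conj b` is multiplicative; `DK ν = conj b(∇_ν)`). [cite: Balaban1984PropagatorsII, (2.51) p.232, bookkeeping] -/
theorem conj_comm_eq (T : (FBondY i → 𝔸) →ₗ[ℂ] (FBondY i → 𝔸)) (ν : Fin (d + 1)) :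
    B9Eq352DivFormLetters.conj b ((T ∘ₗ nablaY i ν - nablaY i ν ∘ₗ T).restrictScalars ℝ) =
      B9Eq352DivFormLetters.conj b (T.restrictScalars ℝ) * DK b i ν - DK b i ν * B9Eq352DivFormLetters.conj b (T.restrictScalars ℝ) := by
  have e : ((T ∘ₗ nablaY i ν - nablaY i ν ∘ₗ T).restrictScalars ℝ) =
      T.restrictScalars ℝ * (nablaY i ν).restrictScalars ℝ - (nablaY i ν).restrictScalars ℝ * T.restrictScalars ℝ :=
    LinearMap.ext fun X => rfl
  rw [e, B9Eq352DivFormLetters.conj_sub, B9Eq352DivFormLetters.conj_mul, B9Eq352DivFormLetters.conj_mul]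
  rfl

/-- the commutator constant of `V¹` (absolute, depending on `d` only). [cite: Balaban1985BackgroundPropagators, (3.73) p.405, bookkeeping] -/
def cK1 (d : ℕ) : ℝ := 4 + 48 * ((d : ℝ) + 1)

variable {V : CfgY 𝔸 i} (hU : ∀ μ x, ‖(V μ x : 𝔸)‖ ≤ 1 ∧ ‖(((V μ x)⁻¹ : 𝔸ˣ) : 𝔸)‖ ≤ 1)
include hU

/-- ★★★ **THE COMMUTATOR LETTER `conj b(V¹_μ)·DK ν − DK ν·conj b(V¹_μ)` HAS A ZEROTH-ORDER MAJORANT OF SIZE `α₁(Lⁿη)⁻²`**: under the VARIATION window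
`‖V_a(y − e_ν) − V_a(y)‖ ≤ α₁(η∕len(a))²` and the PLAQUETTE window `‖Re U(∂p) − 1‖ ≤ α₁(η∕len(a))²` at every site ∕ plaquette whose block is within graph distance `3` of `a`,
and `α₁ ≤ 1`: `conj b(V¹_μ∘∇_ν − ∇_ν∘V¹_μ) ≺ (M₂Σ‖b_j‖)·c_{K1}(d)·e^{3δ}·α₁·(len(a)²)⁻¹·e^{−δd(a,a′)}` over `toB6 (geoCK i □) Rr H` — the divergence-form remainder of
print's first-order operator `V₃(A)` (its `V₁`-half), the (3.37) size of the coefficient differences. [cite: Balaban1985BackgroundPropagators, (3.73) p.405, (3.37) p.396, (3.85) p.407; Balaban1984PropagatorsII, (2.51) p.232] -/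
theorem hasMajorant_commV1Y {M₂ : ℝ} (hM₂ : 0 ≤ M₂) (hrepr : ∀ (v : 𝔸) (j : ιb), |b.repr v j| ≤ M₂ * ‖v‖) {α₁ : ℝ} (hα₁ : 0 ≤ α₁) (hα₁1 : α₁ ≤ 1)
    (ν : Fin (d + 1))
    (hW2 : ∀ (a : BlkCubeY i q) (a' : Fin (d + 1)) (y : Site (PV d ℓ i.m i.K hd hL) 0), dSite i q a y ≤ 3 →
      ‖(V a' (y.unshift ν) : 𝔸) - V a' y‖ ≤ α₁ * ((kGeo i).eta * ((geoCK i q).len a)⁻¹) ^ 2)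
    (hW3 : ∀ (a : BlkCubeY i q) (p : PlaqY i), dSite i q a p.src ≤ 3 → ‖reHolY i V p - 1‖ ≤ α₁ * ((kGeo i).eta * ((geoCK i q).len a)⁻¹) ^ 2)
    {δ : ℝ} (hδ : 0 ≤ δ) (Rr : ℝ) (H : Prop) (μ : Fin (d + 1)) :
    HasMajorant (g := toB6 (geoCK i q) Rr H) (blkBK i q)
      (B9Eq352DivFormLetters.conj b ((V1Y i V μ).restrictScalars ℝ) * DK b i ν - DK b i ν * B9Eq352DivFormLetters.conj b ((V1Y i V μ).restrictScalars ℝ))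
      (fun a a' => (M₂ * ∑ j, ‖b j‖) * (cK1 d * Real.exp (3 * δ) * α₁ * ((geoCK i q).len a ^ 2)⁻¹ * Real.exp (-(δ * (geoCK i q).dist a a')))) := by
  rw [← conj_comm_eq]
  refine B9SectBGpReadingsY.hasMajorant_conj_of_liftY_bound b (g := toB6 (geoCK i q) Rr H) (fun f : FBondY i => blkV1 i.hN (cubeFamY i q) f) _ _
    M₂ hM₂ hrepr fun f E y' B hE hB hoff hbd bb => ?_
  rw [LinearMap.restrictScalars_apply]
  set a := blkV1 i.hN (cubeFamY i q) bb with ha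
  have ha' : a = blkCubeY i q (chartY i bb.src) := rfl
  have hη : 0 < (kGeo i).eta := by rw [← geoCK_eta i q]; exact geoCK_eta_pos i q
  have hlen : 0 < (geoCK i q).len a := geoCK_len_pos i q a
  have hηl : (kGeo i).eta * ((geoCK i q).len a)⁻¹ ≤ 1 := by
    rw [← div_eq_mul_inv, div_le_one hlen, ← geoCK_eta i q]; exact B9CubeGeometryInputs.geoCK_eta_le_len i q a
  set t := (kGeo i).eta * ((geoCK i q).len a)⁻¹ with ht
  have ht0 : 0 ≤ t := by positivity
  have hω0 : 0 ≤ α₁ * t ^ 2 := by positivity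
  have hω1 : α₁ * t ^ 2 ≤ 1 := by
    calc α₁ * t ^ 2 ≤ 1 * 1 ^ 2 := by gcongr
      _ = 1 := by norm_num
  have hct : |i.cf| * t = ((geoCK i q).len a)⁻¹ := by
    rw [abs_cf_eq, ht, ← mul_assoc, inv_mul_cancel₀ hη.ne', one_mul]
  have main : ∀ s : ℝ, 0 ≤ s → (∀ e : FBondY i, dSite i q a e.src ≤ 3 → ‖liftY f E e‖ ≤ s) →
      ‖(V1Y i V μ ∘ₗ nablaY i ν - nablaY i ν ∘ₗ V1Y i V μ) (liftY f E) bb‖ ≤ cK1 d * α₁ * ((geoCK i q).len a ^ 2)⁻¹ * s := by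
    intro s hs hX
    have h := norm_commV1Y_apply_le i q hU μ ν bb hs hω0 hω0 (fun a' y hy => hW2 a a' y (by rw [ha']; exact hy))
      (fun p hp => hW3 a p (by rw [ha']; exact hp)) (liftY f E) (fun e he => hX e (by rw [ha']; exact he))
    refine h.trans ?_
    have h2 : 4 * (α₁ * t ^ 2) + 8 * ((d : ℝ) + 1) * (2 * (α₁ * t ^ 2) * (1 + α₁ * t ^ 2) + 2 * (α₁ * t ^ 2)) ≤ cK1 d * (α₁ * t ^ 2) := by
      rw [cK1]
      have h3 : 2 * (α₁ * t ^ 2) * (1 + α₁ * t ^ 2) ≤ 4 * (α₁ * t ^ 2) := by nlinarith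
      nlinarith [h3, (by positivity : (0 : ℝ) ≤ (d : ℝ) + 1)]
    calc |i.cf| * (|i.cf| * ((4 * (α₁ * t ^ 2) + 8 * ((d : ℝ) + 1) * (2 * (α₁ * t ^ 2) * (1 + α₁ * t ^ 2) + 2 * (α₁ * t ^ 2))) * s))
        ≤ |i.cf| * (|i.cf| * (cK1 d * (α₁ * t ^ 2) * s)) := by gcongr
      _ = cK1 d * α₁ * (|i.cf| * t) ^ 2 * s := by ring
      _ = cK1 d * α₁ * ((geoCK i q).len a ^ 2)⁻¹ * s := by rw [hct, inv_pow]
  have hK0 : 0 ≤ cK1 d * α₁ * ((geoCK i q).len a ^ 2)⁻¹ := by unfold cK1; positivity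
  by_cases hnear : (geoCK i q).dist a y' ≤ 3
  · have h := main B hB (fun e _ => (Node00.norm_liftY_le f ⟨E, mem_closedBall_zero_iff.2 hE⟩ e).trans (hbd e))
    refine h.trans ?_
    have hexp : 1 ≤ Real.exp (3 * δ) * Real.exp (-(δ * (geoCK i q).dist a y')) := by
      rw [← Real.exp_add]; exact Real.one_le_exp (by nlinarith)
    calc cK1 d * α₁ * ((geoCK i q).len a ^ 2)⁻¹ * B = cK1 d * α₁ * ((geoCK i q).len a ^ 2)⁻¹ * 1 * B := by rw [mul_one]
      _ ≤ cK1 d * α₁ * ((geoCK i q).len a ^ 2)⁻¹ * (Real.exp (3 * δ) * Real.exp (-(δ * (geoCK i q).dist a y'))) * B := by gcongr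
      _ = cK1 d * Real.exp (3 * δ) * α₁ * ((geoCK i q).len a ^ 2)⁻¹ * Real.exp (-(δ * (geoCK i q).dist a y')) * B := by ring
  · have h := main 0 le_rfl (fun e he => by
      have hne : blkV1 i.hN (cubeFamY i q) e ≠ y' := by
        intro heq
        apply hnear
        have : dSite i q a e.src = (geoCK i q).dist a y' := by rw [← heq]; rfl
        rw [← this]; exact he
      calc ‖liftY f E e‖ ≤ |f e| := Node00.norm_liftY_le f ⟨E, mem_closedBall_zero_iff.2 hE⟩ e
        _ = 0 := by rw [hoff e hne, abs_zero])
    rw [mul_zero] at h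
    exact h.trans (mul_nonneg (by unfold cK1; positivity) hB)

/-- ★★★ **THE COMMUTATOR LETTER `conj b(P¹_μ)·DK ν − DK ν·conj b(P¹_μ)`**: under the variation window `‖V_a(y − e_ν) − V_a(y)‖ ≤ α₁(η∕len(a))²` in the distance-3
block neighbourhood, `conj b(P¹_μ∘∇_ν − ∇_ν∘P¹_μ) ≺ (M₂Σ‖b_j‖)·c_{P1}(d)·e^{3δ}·α₁·(len(a)²)⁻¹·e^{−δd(a,a′)}` over `toB6 (geoCK i □) Rr H` (the `V₂`-half of `V₃(A)`).
[cite: Balaban1985BackgroundPropagators, (3.75) p.405, (3.73) p.405, (3.37) p.396, (3.85) p.407; Balaban1984PropagatorsII, (2.51) p.232] -/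
theorem hasMajorant_commP1Y {M₂ : ℝ} (hM₂ : 0 ≤ M₂) (hrepr : ∀ (v : 𝔸) (j : ιb), |b.repr v j| ≤ M₂ * ‖v‖) {α₁ : ℝ} (hα₁ : 0 ≤ α₁)
    (ν : Fin (d + 1))
    (hW2 : ∀ (a : BlkCubeY i q) (a' : Fin (d + 1)) (y : Site (PV d ℓ i.m i.K hd hL) 0), dSite i q a y ≤ 3 →
      ‖(V a' (y.unshift ν) : 𝔸) - V a' y‖ ≤ α₁ * ((kGeo i).eta * ((geoCK i q).len a)⁻¹) ^ 2)
    {δ : ℝ} (hδ : 0 ≤ δ) (Rr : ℝ) (H : Prop) (μ : Fin (d + 1)) :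
    HasMajorant (g := toB6 (geoCK i q) Rr H) (blkBK i q)
      (B9Eq352DivFormLetters.conj b ((P1Y i V μ).restrictScalars ℝ) * DK b i ν - DK b i ν * B9Eq352DivFormLetters.conj b ((P1Y i V μ).restrictScalars ℝ))
      (fun a a' => (M₂ * ∑ j, ‖b j‖) * (cP1 d * Real.exp (3 * δ) * α₁ * ((geoCK i q).len a ^ 2)⁻¹ * Real.exp (-(δ * (geoCK i q).dist a a')))) := by
  rw [← conj_comm_eq]
  refine B9SectBGpReadingsY.hasMajorant_conj_of_liftY_bound b (g := toB6 (geoCK i q) Rr H) (fun f : FBondY i => blkV1 i.hN (cubeFamY i q) f) _ _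
    M₂ hM₂ hrepr fun f E y' B hE hB hoff hbd bb => ?_
  rw [LinearMap.restrictScalars_apply]
  set a := blkV1 i.hN (cubeFamY i q) bb with ha
  have ha' : a = blkCubeY i q (chartY i bb.src) := rfl
  have hη : 0 < (kGeo i).eta := by rw [← geoCK_eta i q]; exact geoCK_eta_pos i q
  have hlen : 0 < (geoCK i q).len a := geoCK_len_pos i q a
  set t := (kGeo i).eta * ((geoCK i q).len a)⁻¹ with ht
  have ht0 : 0 ≤ t := by positivity
  have hω0 : 0 ≤ α₁ * t ^ 2 := by positivity
  have hct : |i.cf| * t = ((geoCK i q).len a)⁻¹ := by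
    rw [abs_cf_eq, ht, ← mul_assoc, inv_mul_cancel₀ hη.ne', one_mul]
  have main : ∀ s : ℝ, 0 ≤ s → (∀ e : FBondY i, dSite i q a e.src ≤ 3 → ‖liftY f E e‖ ≤ s) →
      ‖(P1Y i V μ ∘ₗ nablaY i ν - nablaY i ν ∘ₗ P1Y i V μ) (liftY f E) bb‖ ≤ cP1 d * α₁ * ((geoCK i q).len a ^ 2)⁻¹ * s := by
    intro s hs hX
    have h := norm_commP1Y_apply_le i q hU μ ν bb hs hω0 (fun a' y hy => hW2 a a' y (by rw [ha']; exact hy)) (liftY f E)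
      (fun e he => hX e (by rw [ha']; exact he))
    refine h.trans (le_of_eq ?_)
    calc |i.cf| * (|i.cf| * (cP1 d * (α₁ * t ^ 2) * s)) = cP1 d * α₁ * (|i.cf| * t) ^ 2 * s := by ring
      _ = cP1 d * α₁ * ((geoCK i q).len a ^ 2)⁻¹ * s := by rw [hct, inv_pow]
  have hK0 : 0 ≤ cP1 d * α₁ * ((geoCK i q).len a ^ 2)⁻¹ := by unfold cP1; positivity
  by_cases hnear : (geoCK i q).dist a y' ≤ 3
  · have h := main B hB (fun e _ => (Node00.norm_liftY_le f ⟨E, mem_closedBall_zero_iff.2 hE⟩ e).trans (hbd e))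
    refine h.trans ?_
    have hexp : 1 ≤ Real.exp (3 * δ) * Real.exp (-(δ * (geoCK i q).dist a y')) := by
      rw [← Real.exp_add]; exact Real.one_le_exp (by nlinarith)
    calc cP1 d * α₁ * ((geoCK i q).len a ^ 2)⁻¹ * B = cP1 d * α₁ * ((geoCK i q).len a ^ 2)⁻¹ * 1 * B := by rw [mul_one]
      _ ≤ cP1 d * α₁ * ((geoCK i q).len a ^ 2)⁻¹ * (Real.exp (3 * δ) * Real.exp (-(δ * (geoCK i q).dist a y'))) * B := by gcongr
      _ = cP1 d * Real.exp (3 * δ) * α₁ * ((geoCK i q).len a ^ 2)⁻¹ * Real.exp (-(δ * (geoCK i q).dist a y')) * B := by ring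
  · have h := main 0 le_rfl (fun e he => by
      have hne : blkV1 i.hN (cubeFamY i q) e ≠ y' := by
        intro heq
        apply hnear
        have : dSite i q a e.src = (geoCK i q).dist a y' := by rw [← heq]; rfl
        rw [← this]; exact he
      calc ‖liftY f E e‖ ≤ |f e| := Node00.norm_liftY_le f ⟨E, mem_closedBall_zero_iff.2 hE⟩ e
        _ = 0 := by rw [hoff e hne, abs_zero])
    rw [mul_zero] at h
    exact h.trans (mul_nonneg (by unfold cP1; positivity) hB)

end Majorant

/-! ## §6  ★★★ AT THE LOCALISED FIELD `Ṽ_□ = e^{iηχ̃_□A}` OF THE (3.35) CUBE DATUM: the two commutator letters from bridge II's windows (uniform on the torus) -/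

section AtLocCfg

open Complex

variable {ιb : Type} [Fintype ιb] (b : Module.Basis ιb ℝ 𝔸)
variable (c : ↥(cubes (toKT i).D.toDomains))
variable {A : AfldY 𝔸 i} {Q : Set (Site (PV d ℓ i.m i.K hd hL) 0)} {C ξ Λ : ℝ} (hC : 0 ≤ C) (hξ : 0 < ξ) (hΛ : 1 ≤ Λ)
    (hξS : ξ ≤ 5 * (SC i c : ℝ) * (kGeo i).eta) (hΛξ : LatticeNorms.scaleLen ((ℓ : ℝ) + 1) (kGeo i).eta (c.1.1 + 1) ≤ Λ * ξ)
    (hQ : ∀ x : Site (PV d ℓ i.m i.K hd hL) 0, NearC i c (35 * SC i c / 8 + 1) (boxEquiv i.hN x).1 → x ∈ Q)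
    (hA : ∀ κ, ∀ x ∈ Q, ‖A κ x‖ ≤ C * ξ⁻¹)
    (hdA : ∀ μ ν, ∀ x ∈ Q, ‖(((kGeo i).eta : ℂ)⁻¹) • covD (shiftsV1 (PV d ℓ i.m i.K hd hL)) (fun _ _ => (1 : 𝔸ˣ)) μ (A ν) x‖ ≤ C * (ξ ^ 2)⁻¹)
    (hAu : ∀ (t : ℝ) (κ : Fin (d + 1)) (x : Site (PV d ℓ i.m i.K hd hL) 0), ‖NormedSpace.exp ((I * (t : ℂ)) • A κ x)‖ ≤ 1)
    {M₂ : ℝ} (hM₂ : 0 ≤ M₂) (hrepr : ∀ (v : 𝔸) (j : ιb), |b.repr v j| ≤ M₂ * ‖v‖)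
include hC hξ hΛ hξS hΛξ hQ hA hdA hAu hM₂ hrepr

/-- ★★★ **THE `V¹`-COMMUTATOR LETTER AT `Ṽ_□` FROM THE (3.35) CUBE DATUM** (bridge II's variation and plaquette windows, uniform on the torus; `α_W(s) ≤ 1`):
`conj b(V¹_μ(Ṽ_□))·DK ν − DK ν·conj b(V¹_μ(Ṽ_□)) ≺ (M₂Σ‖b_j‖)·c_{K1}(d)·e^{3δ}·α_W(s)·(len(a)²)⁻¹·e^{−δd(a,a′)}` over `toB6 (geoCK i □) Rr H`.
[cite: Balaban1985BackgroundPropagators, (3.73) p.405, (3.37) p.396, Cor. 3.6 p.408, (3.85)–(3.86) p.407; Balaban1984PropagatorsII, (2.51) p.232] -/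
theorem hasMajorant_commV1Y_locCfgY [NormOneClass 𝔸] (hsmall : alphaW (sRead C Λ) ≤ 1) {δ : ℝ} (hδ : 0 ≤ δ) (Rr : ℝ) (H : Prop) (μ ν : Fin (d + 1)) :
    HasMajorant (g := toB6 (geoCK i c) Rr H) (blkBK i c)
      (B9Eq352DivFormLetters.conj b ((V1Y i (locCfgY i c (kGeo i).eta A) μ).restrictScalars ℝ) * DK b i ν -
        DK b i ν * B9Eq352DivFormLetters.conj b ((V1Y i (locCfgY i c (kGeo i).eta A) μ).restrictScalars ℝ))
      (fun a a' => (M₂ * ∑ j, ‖b j‖) *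
        (cK1 d * Real.exp (3 * δ) * alphaW (sRead C Λ) * ((geoCK i c).len a ^ 2)⁻¹ * Real.exp (-(δ * (geoCK i c).dist a a')))) := by
  have hU := unitaryLike_locCfgY i c hAu (kGeo i).eta
  refine hasMajorant_commV1Y i c b hU hM₂ hrepr (alphaW_nonneg (sRead_nonneg hC Λ)) hsmall ν (fun a a' y _ => ?_) (fun a p _ => ?_) hδ Rr H μ
  · obtain ⟨h1, h2⟩ := len_bounds i c hΛξ a
    rw [norm_sub_rev]
    refine (norm_locCfgY_sub_unshift_le i c hC hξ hΛ hξS hQ hA hdA h1 h2 a' ν y).trans ?_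
    exact mul_le_mul_of_nonneg_right (mul_exp_le_alphaW (sRead_nonneg hC Λ)) (sq_nonneg _)
  · obtain ⟨h1, h2⟩ := len_bounds i c hΛξ a
    exact (norm_reHolY_imHolY_locCfgY_le i c hC hξ hΛ hξS hQ hA hdA hU h1 h2 p).1

/-- ★★★ **THE `P¹`-COMMUTATOR LETTER AT `Ṽ_□` FROM THE (3.35) CUBE DATUM**:
`conj b(P¹_μ(Ṽ_□))·DK ν − DK ν·conj b(P¹_μ(Ṽ_□)) ≺ (M₂Σ‖b_j‖)·c_{P1}(d)·e^{3δ}·α_W(s)·(len(a)²)⁻¹·e^{−δd(a,a′)}` over `toB6 (geoCK i □) Rr H`.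
[cite: Balaban1985BackgroundPropagators, (3.73) p.405, (3.75) p.405, (3.37) p.396, Cor. 3.6 p.408, (3.85)–(3.86) p.407; Balaban1984PropagatorsII, (2.51) p.232] -/
theorem hasMajorant_commP1Y_locCfgY [NormOneClass 𝔸] {δ : ℝ} (hδ : 0 ≤ δ) (Rr : ℝ) (H : Prop) (μ ν : Fin (d + 1)) :
    HasMajorant (g := toB6 (geoCK i c) Rr H) (blkBK i c)
      (B9Eq352DivFormLetters.conj b ((P1Y i (locCfgY i c (kGeo i).eta A) μ).restrictScalars ℝ) * DK b i ν -
        DK b i ν * B9Eq352DivFormLetters.conj b ((P1Y i (locCfgY i c (kGeo i).eta A) μ).restrictScalars ℝ))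
      (fun a a' => (M₂ * ∑ j, ‖b j‖) *
        (cP1 d * Real.exp (3 * δ) * alphaW (sRead C Λ) * ((geoCK i c).len a ^ 2)⁻¹ * Real.exp (-(δ * (geoCK i c).dist a a')))) := by
  have hU := unitaryLike_locCfgY i c hAu (kGeo i).eta
  refine hasMajorant_commP1Y i c b hU hM₂ hrepr (alphaW_nonneg (sRead_nonneg hC Λ)) ν (fun a a' y _ => ?_) hδ Rr H μ
  obtain ⟨h1, h2⟩ := len_bounds i c hΛξ a
  rw [norm_sub_rev]
  refine (norm_locCfgY_sub_unshift_le i c hC hξ hΛ hξS hQ hA hdA h1 h2 a' ν y).trans ?_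
  exact mul_le_mul_of_nonneg_right (mul_exp_le_alphaW (sRead_nonneg hC Λ)) (sq_nonneg _)

end AtLocCfg

end Literature.MathematicalPhysics.QuantumFieldTheory.Balaban1983to89.B9Ineq373FirstOrderCommY

end
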